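import Summits.QuantumFields.BalabanUV.T4Continuum.Support.ShellMeasureGradientPinnedLocal

/-!
# `T4Continuum.ShellMeasureGradientPinnedLocalEnd` — row S70 companion GP (file 2∕2): THE HESSIAN KERNEL OF A LOCAL
# ACTION IS FINITE-RANGE ⟹ END-II's (P4) LETTER `W = tail₂ (locGrad V)` IS PINNED-LIPSCHITZ ON THE FLAT BALL WITH A
# VOLUME-FREE CONSTANT, FOR EVERY PIN RATE — the `D(W𝒱)` factor of row S70 (ii) ∕ f2's (F2) binder needs NO decay display
(cell `pub-balaban`, sub-cell `t4`, spine estimate NE7c (node U5b); NE7c ROUND-2 crew, unit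
`b2b-balaban-t4-ne7c-formalise-leaf-06` gen 5, owner table `t4/b2b-balaban-t4-ne7c-p1/LEAVES-NE7c-P1.md` row S70
(holder leaf-01-g6) — companion GP; imports file 1∕2 `ShellMeasureGradientPinnedLocal` (this unit) ONLY; [folklore];
0 `def`, 0 `def … : Prop`, 0 sorry, 0 citations)

HONEST FRAMING.  Finite four-torus programme, rung (B)+1 only — NOT infinite volume, NOT a mass gap, NOT the Clay
problem, NOT summit progress; (B), `BetaPertHyp`, (B^μ) are not consumed.  NE7c (`T4IndicatorShell.ShellWeightBound`)
is NOT PRINTED in [Balaban 1983–89] and NOT PROVED; «NE7c ⇐ the named binders» (trigger c3, WALL §2).  Elementary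
calculus and finite sums on OUR side; nothing printed is asserted or cited as a fact ([Balaban1985Variational] (90),
(97)∕(98), (121) are LOCATORS for shapes); no estimate of Bałaban's at a live level is discharged; NOTHING in the
countdown moves.  HONEST DEPENDENCY (cell): continuum YM on T⁴ ⇐ BetaPertH ∧ nine spine estimates (0/9 proved);
BetaPertH ⇐ (D1) ∧ (D4) ∧ CAP+tail; G-an2-4 gates asym, D1 and NE2/3/4.

DATA (= S62 f1 `ShellMeasureLocalGradientTail.prop4Hyp_locGrad`'s, plus two counting numbers and a pin profile): a
finite plaquette set `Pl`, functionals `φ_p` analytic with `‖φ_p‖ ≤ M₀` on the flat `ball 0 R` of the bond-field space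
`Λ → 𝔄` and LOCAL to `supp p` (`φ_p (A + ι_b X) = φ_p A` for `b ∉ supp p`); incidence `#{p : b ∈ supp p} ≤ m`; bonds per
plaquette `#supp p ≤ s`; a pin profile `ϖ : Λ → ℝ` growing by at most `r₀` inside a plaquette (`ϖ c ≤ ϖ b + r₀` for
`b, c ∈ supp p` — e.g. `r₀` = a plaquette's diameter in the pin's metric); a rate `δ′ ≥ 0`.  `V := Σ_{p ∈ Pl} φ_p`,
`W := tail₂ (locGrad V)` (END-II's nonlinearity: the order-≥2 part of the bond-local gradient).
WHAT IS PROVED ([folklore]).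
* §4 THE HESSIAN KERNEL OF THE (P4) LETTER: `fderiv_tail₂`∕`dker_tail₂` (the tail's derivative is `DG(A) − DG(0)`);
  **`dker_locGrad_eq`**: on the ball, `dker (locGrad V) A c b = Σ_{p ∈ Pl, c ∈ supp p} h_{p,c,b}(A)` (B11 (90) TYPE —
  only the plaquettes through the OUTPUT bond; `locGrad_sum_eq_filter`, `fderiv_apply`, `fderiv_fun_sum`);
  `dker_tail₂_locGrad_eq`; **`dker_tail₂_locGrad_eq_zero`**: the kernel VANISHES unless `b ∈ ⋃_{p ∋ c} supp p`
  (FINITE RANGE); **`rangeRowSum_dker_tail₂_locGrad_le`**: for `A ∈ ball 0 (R∕4)` the range row sums are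
  `≤ m·s·(64M₀∕R³)·‖A‖` — incidence × one plaquette, LINEAR IN THE SIZE like (121)'s `4B₀C₄(ε₄ + a)`, NO volume.
* §5 THE END: `norm_sub_pin_le_of_kerOpPin_le_convex` (file 1 §2's mean value on ANY convex flat set);
  `opNorm_kerOpPin_dker_tail₂_locGrad_le` (`‖kerOpPin (dker W A) δ′ ϖ ϖ‖ ≤ m·s·(64M₀∕R³)·e^{δ′r₀}·‖A‖` on
  `ball 0 (R∕4)`, file 1 §1); **`norm_sub_pin_tail₂_locGrad_le`**: for `A, A′` in the flat `ball 0 ρ`, `ρ ≤ R∕4`,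
  `‖W A − W A′‖_pin ≤ (m·s·(64M₀∕R³)·e^{δ′r₀}·ρ)·‖A − A′‖_pin` in S69's `WSup (pinW δ′ ϖ) 1` — VOLUME-FREE, `T`-free,
  valid for EVERY `δ′ ≥ 0` (no `δ′ < δ₀`: a local letter costs only `e^{δ′·range}`); **`norm_pin_tail₂_locGrad_le`**
  (sharp variation, `W 0 = 0`): `‖W A‖_pin ≤ (m·s·(64M₀∕R³)·e^{δ′r₀}·‖A‖_flat)·‖A‖_pin` on `ball 0 (R∕4)`;
  **`prop4Hyp_pinned_tail₂_locGrad`** (`0 ≤ δ′`, `0 ≤ ϖ`): END-II's OWN SHAPE `B11Prop6Scheme.Prop4Hyp` for the letter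
  READ BETWEEN THE PINNED SPACES, `Y ↦ toPiL⁻¹ (W (toPiL Y)) : WSup (pinW δ′ ϖ) 1 𝔄 → WSup (pinW δ′ ϖ) 1 (𝔄 →L ℂ)`, with
  `C₄ = m·s·(64M₀∕R³)·e^{δ′r₀}` and `a₃ = R∕4` — the `hW` binder of row S70 f3's END-II-loc
  (`ShellMeasureLandauPinnedEnd.slotAC_realized_su2_landauChart_pinned`, 𝒴 := `WSup (pinW δ′ ϖ) 1 𝔄`) for the
  ∇-free, `HD`-free one-grid letter: the bridge «derivative kernel ⇒ pinned `Prop4Hyp`» its author left OPEN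
  (journal l.16737), here with NO decay display at all.
USE (by NAME, nobody's file edited): leaf-07-g6's (F2) binder is `q_W(F2) = ‖𝒢‖_{pin→pin} · (m·s·(64M₀∕R³)·ρ·e^{δ′r₀})`
with `‖𝒢‖_{pin→pin}` from S70 f1 (S69 (A) on (3.133)-TYPE decay — DISPLAYED) and `ρ = ε₄ + a` the scheme's radius; S70
f1 may drop the decay display for `D(W𝒱)`.  NOT HERE: the multi-grid weighted twin (S65 f2b currency `w`, `W p`, `Lc`,
polydiscs), the `HD`-dressing and `∇`-part of (80)∕(98), `𝒢`'s decay, [dict] — displayed or elsewhere.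
-/

noncomputable section

open Metric Set Function Filter
open scoped Topology

namespace Summit.QuantumFields.BalabanUV.T4Continuum.ShellMeasureGradientPinnedLocalEnd

open Literature.MathematicalPhysics.QuantumFieldTheory.Balaban1983to89
open Summit.QuantumFields.BalabanUV.T4Continuum.ShellMeasureMultiGridNorms (WSup)
open Summit.QuantumFields.BalabanUV.T4Continuum.ShellMeasurePinnedNorm (pinW kerOpPin)
open B11Prop6Scheme (Prop4Hyp)
open Summit.QuantumFields.BalabanUV.T4Continuum.ShellMeasureDecayKernelTail (dker dker_apply)
open Summit.QuantumFields.BalabanUV.T4Continuum.ShellMeasureLocalGradientTail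
  (sgl locGrad locGrad_sum_eq_filter tail₂ differentiableOn_locGrad analyticOnNhd_sum)
open Summit.QuantumFields.BalabanUV.T4Continuum.ShellMeasureGradientPinnedLocal
  (opNorm_kerOpPin_le_of_finiteRange hasFDerivAt_conj analyticOnNhd_fderiv_comp_sgl hessEntry_eq_zero_of_not_mem
    norm_hessEntry_sub_le)

variable {Λ Λ' : Type*} [Fintype Λ] [Fintype Λ'] {𝔄 𝔅 : Type*} [NormedAddCommGroup 𝔄] [NormedSpace ℂ 𝔄]
  [NormedAddCommGroup 𝔅] [NormedSpace ℂ 𝔅]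

/-! ## §4 The Hessian kernel of the (P4) letter `W = tail₂ (locGrad V)`, `V = Σ_p φ_p` -/

section Hessian

variable [DecidableEq Λ] {P : Type*} (Pl : Finset P) (φ : P → (Λ → 𝔄) → ℂ) (supp : P → Finset Λ)

omit [Fintype Λ] in
/-- membership in the RANGE `N c = ⋃_{p ∋ c} supp p` of the Hessian kernel. [folklore] -/
theorem mem_range_iff {c b : Λ} :
    b ∈ (Pl.filter fun p => c ∈ supp p).biUnion supp ↔ ∃ p ∈ Pl, c ∈ supp p ∧ b ∈ supp p := by
  simp only [Finset.mem_biUnion, Finset.mem_filter, and_assoc]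

omit [DecidableEq Λ] in
/-- The derivative of the 2-tail is the derivative minus the derivative at the origin. [folklore] -/
theorem fderiv_tail₂ {G : (Λ → 𝔄) → (Λ' → 𝔅)} {A : Λ → 𝔄} (hG : DifferentiableAt ℂ G A) :
    fderiv ℂ (tail₂ G) A = fderiv ℂ G A - fderiv ℂ G 0 := by
  have h : HasFDerivAt (tail₂ G) (fderiv ℂ G A - fderiv ℂ G 0) A :=
    (hG.hasFDerivAt.sub_const (G 0)).fun_sub (fderiv ℂ G 0).hasFDerivAt
  exact h.fderiv

omit [Fintype Λ'] in
/-- … hence entrywise: `dker (tail₂ G) A c b = dker G A c b − dker G 0 c b`. [folklore] -/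
theorem dker_tail₂ [Fintype Λ'] {G : (Λ → 𝔄) → (Λ' → 𝔅)} {A : Λ → 𝔄} (hG : DifferentiableAt ℂ G A) (c : Λ') (b : Λ) :
    dker (tail₂ G) A c b = dker G A c b - dker G 0 c b := by
  ext X
  rw [dker_apply, fderiv_tail₂ hG]
  rfl

variable {R M₀ : ℝ}

/-- **THE HESSIAN KERNEL OF A LOCAL SUM.**  On `ball 0 R` (every `φ_p` analytic there, LOCAL to `supp p`):
`dker (locGrad V) A c b = Σ_{p ∈ Pl, c ∈ supp p} h_{p,c,b}(A)` — only the plaquettes through the OUTPUT bond `c`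
contribute (B11 (90) TYPE, `locGrad_sum_eq_filter`). [folklore] -/
theorem dker_locGrad_eq (ha : ∀ p ∈ Pl, AnalyticOnNhd ℂ (φ p) (ball 0 R))
    (hloc : ∀ p ∈ Pl, ∀ A : Λ → 𝔄, ∀ b ∉ supp p, ∀ X : 𝔄, φ p (A + Pi.single b X) = φ p A)
    {A : Λ → 𝔄} (hA : A ∈ ball (0 : Λ → 𝔄) R) (c b : Λ) :
    dker (locGrad (fun A => ∑ p ∈ Pl, φ p A)) A c b =
      ∑ p ∈ Pl.filter (fun p => c ∈ supp p),
        (fderiv ℂ (fun A' : Λ → 𝔄 => (fderiv ℂ (φ p) A').comp (sgl c)) A).comp (sgl b) := by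
  have hVa : AnalyticOnNhd ℂ (fun A => ∑ p ∈ Pl, φ p A) (ball (0 : Λ → 𝔄) R) := analyticOnNhd_sum Pl φ ha
  have hGd : DifferentiableAt ℂ (locGrad (fun A => ∑ p ∈ Pl, φ p A)) A :=
    (differentiableOn_locGrad hVa).differentiableAt (isOpen_ball.mem_nhds hA)
  -- the `c`-component of `locGrad V` agrees near `A` with the sum over the plaquettes through `c`
  have heq : (fun A' => locGrad (fun A => ∑ p ∈ Pl, φ p A) A' c) =ᶠ[𝓝 A]
      fun A' => ∑ p ∈ Pl.filter (fun p => c ∈ supp p), (fderiv ℂ (φ p) A').comp (sgl c) :=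
    Filter.eventuallyEq_of_mem (isOpen_ball.mem_nhds hA) fun A' hA' =>
      locGrad_sum_eq_filter Pl φ supp (fun p hp => ((ha p hp) A' hA').differentiableAt) hloc c
  have hdiff : ∀ p ∈ Pl.filter (fun p => c ∈ supp p),
      DifferentiableAt ℂ (fun A' : Λ → 𝔄 => (fderiv ℂ (φ p) A').comp (sgl c)) A := fun p hp =>
    ((analyticOnNhd_fderiv_comp_sgl (ha p (Finset.mem_of_mem_filter p hp)) c) A hA).differentiableAt
  unfold dker
  rw [← ContinuousLinearMap.comp_assoc, ← fderiv_apply hGd c, heq.fderiv_eq, fderiv_fun_sum hdiff,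
    ContinuousLinearMap.finsetSum_comp]

/-- **THE HESSIAN KERNEL OF THE (P4) LETTER**: on `ball 0 R`,
`dker (tail₂ (locGrad V)) A c b = Σ_{p ∈ Pl, c ∈ supp p} (h_{p,c,b}(A) − h_{p,c,b}(0))`. [folklore] -/
theorem dker_tail₂_locGrad_eq (hR : 0 < R) (ha : ∀ p ∈ Pl, AnalyticOnNhd ℂ (φ p) (ball 0 R))
    (hloc : ∀ p ∈ Pl, ∀ A : Λ → 𝔄, ∀ b ∉ supp p, ∀ X : 𝔄, φ p (A + Pi.single b X) = φ p A)
    {A : Λ → 𝔄} (hA : A ∈ ball (0 : Λ → 𝔄) R) (c b : Λ) :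
    dker (tail₂ (locGrad (fun A => ∑ p ∈ Pl, φ p A))) A c b =
      ∑ p ∈ Pl.filter (fun p => c ∈ supp p),
        ((fderiv ℂ (fun A' : Λ → 𝔄 => (fderiv ℂ (φ p) A').comp (sgl c)) A).comp (sgl b) -
          (fderiv ℂ (fun A' : Λ → 𝔄 => (fderiv ℂ (φ p) A').comp (sgl c)) 0).comp (sgl b)) := by
  have hVa : AnalyticOnNhd ℂ (fun A => ∑ p ∈ Pl, φ p A) (ball (0 : Λ → 𝔄) R) := analyticOnNhd_sum Pl φ ha
  have hGd : DifferentiableAt ℂ (locGrad (fun A => ∑ p ∈ Pl, φ p A)) A :=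
    (differentiableOn_locGrad hVa).differentiableAt (isOpen_ball.mem_nhds hA)
  rw [dker_tail₂ hGd, dker_locGrad_eq Pl φ supp ha hloc hA c b,
    dker_locGrad_eq Pl φ supp ha hloc (mem_ball_self hR) c b, ← Finset.sum_sub_distrib]

/-- **FINITE RANGE**: the Hessian kernel of the (P4) letter VANISHES unless the input bond `b` lies in a plaquette
through the output bond `c` (`b ∈ ⋃_{p ∋ c} supp p`). [folklore] -/
theorem dker_tail₂_locGrad_eq_zero (hR : 0 < R) (ha : ∀ p ∈ Pl, AnalyticOnNhd ℂ (φ p) (ball 0 R))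
    (hloc : ∀ p ∈ Pl, ∀ A : Λ → 𝔄, ∀ b ∉ supp p, ∀ X : 𝔄, φ p (A + Pi.single b X) = φ p A)
    {A : Λ → 𝔄} (hA : A ∈ ball (0 : Λ → 𝔄) R) (c : Λ) {b : Λ}
    (hb : b ∉ (Pl.filter fun p => c ∈ supp p).biUnion supp) :
    dker (tail₂ (locGrad (fun A => ∑ p ∈ Pl, φ p A))) A c b = 0 := by
  rw [dker_tail₂_locGrad_eq Pl φ supp hR ha hloc hA c b]
  refine Finset.sum_eq_zero fun p hp => ?_
  have hpP : p ∈ Pl := Finset.mem_of_mem_filter p hp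
  have hbp : b ∉ supp p := fun hbp => hb (Finset.mem_biUnion.2 ⟨p, hp, hbp⟩)
  rw [hessEntry_eq_zero_of_not_mem (hloc p hpP) c hbp A, hessEntry_eq_zero_of_not_mem (hloc p hpP) c hbp 0]
  exact sub_self (0 : 𝔄 →L[ℂ] (𝔄 →L[ℂ] ℂ))

/-- **THE RANGE ROW SUMS ARE LINEAR IN THE SIZE OF THE FIELD**: for `A ∈ ball 0 (R∕4)`, with `‖φ_p‖ ≤ M₀` on
`ball 0 R`, incidence `#{p : c ∈ supp p} ≤ m` and `#supp p ≤ s`: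
`Σ_{b ∈ N c} ‖dker W A c b‖ ≤ m·s·(64M₀∕R³)·‖A‖` — incidence × one plaquette, NO volume; linear in `‖A‖` like (121)'s
`4B₀C₄(ε₄ + a)` is linear in the radius. [folklore] -/
theorem rangeRowSum_dker_tail₂_locGrad_le {m s : ℕ} (hR : 0 < R) (hM₀ : 0 ≤ M₀)
    (ha : ∀ p ∈ Pl, AnalyticOnNhd ℂ (φ p) (ball 0 R))
    (hM : ∀ p ∈ Pl, ∀ A ∈ ball (0 : Λ → 𝔄) R, ‖φ p A‖ ≤ M₀)
    (hloc : ∀ p ∈ Pl, ∀ A : Λ → 𝔄, ∀ b ∉ supp p, ∀ X : 𝔄, φ p (A + Pi.single b X) = φ p A)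
    (hm : ∀ b : Λ, (Pl.filter (fun p => b ∈ supp p)).card ≤ m) (hs : ∀ p ∈ Pl, (supp p).card ≤ s)
    {A : Λ → 𝔄} (hA : A ∈ ball (0 : Λ → 𝔄) (R / 4)) (c : Λ) :
    ∑ b ∈ (Pl.filter fun p => c ∈ supp p).biUnion supp,
        ‖dker (tail₂ (locGrad (fun A => ∑ p ∈ Pl, φ p A))) A c b‖ ≤ m * s * (64 * M₀ / R ^ 3) * ‖A‖ := by
  have hAR : A ∈ ball (0 : Λ → 𝔄) R := ball_subset_ball (by linarith) hA
  have h04 : (0 : Λ → 𝔄) ∈ ball (0 : Λ → 𝔄) (R / 4) := mem_ball_self (by positivity)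
  -- abbreviate the per-plaquette entry differences `e p b = h_{p,c,b}(A) − h_{p,c,b}(0)`
  obtain ⟨e, he⟩ : ∃ e : P → Λ → (𝔄 →L[ℂ] (𝔄 →L[ℂ] ℂ)), ∀ p b, e p b =
      (fderiv ℂ (fun A' : Λ → 𝔄 => (fderiv ℂ (φ p) A').comp (sgl c)) A).comp (sgl b) -
        (fderiv ℂ (fun A' : Λ → 𝔄 => (fderiv ℂ (φ p) A').comp (sgl c)) 0).comp (sgl b) :=
    ⟨_, fun _ _ => rfl⟩
  have hker : ∀ b, dker (tail₂ (locGrad (fun A => ∑ p ∈ Pl, φ p A))) A c b =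
      ∑ p ∈ Pl.filter (fun p => c ∈ supp p), e p b := fun b => by
    rw [dker_tail₂_locGrad_eq Pl φ supp hR ha hloc hAR c b]
    exact Finset.sum_congr rfl fun p _ => (he p b).symm
  have hzero : ∀ p ∈ Pl.filter (fun p => c ∈ supp p), ∀ b ∉ supp p, e p b = 0 := fun p hp b hb => by
    have hpP : p ∈ Pl := Finset.mem_of_mem_filter p hp
    rw [he, hessEntry_eq_zero_of_not_mem (hloc p hpP) c hb A, hessEntry_eq_zero_of_not_mem (hloc p hpP) c hb 0]
    exact sub_self (0 : 𝔄 →L[ℂ] (𝔄 →L[ℂ] ℂ))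
  have hterm : ∀ p ∈ Pl.filter (fun p => c ∈ supp p), ∀ b, ‖e p b‖ ≤ 64 * M₀ / R ^ 3 * ‖A‖ := fun p hp b => by
    have hpP : p ∈ Pl := Finset.mem_of_mem_filter p hp
    have h := norm_hessEntry_sub_le hR hM₀ (ha p hpP) (hM p hpP) c b hA h04
    have hn : ‖A - (0 : Λ → 𝔄)‖ = ‖A‖ := by rw [sub_zero]
    rw [hn] at h
    rw [he]
    exact h
  have hinner : ∀ p ∈ Pl.filter (fun p => c ∈ supp p),
      ∑ b ∈ (Pl.filter fun p => c ∈ supp p).biUnion supp, ‖e p b‖ ≤ s * (64 * M₀ / R ^ 3 * ‖A‖) := fun p hp => by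
    have hsub : supp p ⊆ (Pl.filter fun p => c ∈ supp p).biUnion supp := Finset.subset_biUnion_of_mem supp hp
    rw [← Finset.sum_subset hsub fun b _ hb => by
      rw [hzero p hp b hb]; exact norm_zero (E := 𝔄 →L[ℂ] (𝔄 →L[ℂ] ℂ))]
    calc ∑ b ∈ supp p, ‖e p b‖ ≤ ∑ _b ∈ supp p, 64 * M₀ / R ^ 3 * ‖A‖ :=
          Finset.sum_le_sum fun b _ => hterm p hp b
      _ = ((supp p).card : ℝ) * (64 * M₀ / R ^ 3 * ‖A‖) := by rw [Finset.sum_const, nsmul_eq_mul]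
      _ ≤ s * (64 * M₀ / R ^ 3 * ‖A‖) :=
          mul_le_mul_of_nonneg_right (by exact_mod_cast hs p (Finset.mem_of_mem_filter p hp)) (by positivity)
  calc ∑ b ∈ (Pl.filter fun p => c ∈ supp p).biUnion supp, ‖dker (tail₂ (locGrad (fun A => ∑ p ∈ Pl, φ p A))) A c b‖
      = ∑ b ∈ (Pl.filter fun p => c ∈ supp p).biUnion supp, ‖∑ p ∈ Pl.filter (fun p => c ∈ supp p), e p b‖ :=
        Finset.sum_congr rfl fun b _ => by rw [hker b]
    _ ≤ ∑ b ∈ (Pl.filter fun p => c ∈ supp p).biUnion supp, ∑ p ∈ Pl.filter (fun p => c ∈ supp p), ‖e p b‖ :=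
        Finset.sum_le_sum fun b _ => norm_sum_le (E := 𝔄 →L[ℂ] (𝔄 →L[ℂ] ℂ)) _ fun p => e p b
    _ = ∑ p ∈ Pl.filter (fun p => c ∈ supp p), ∑ b ∈ (Pl.filter fun p => c ∈ supp p).biUnion supp, ‖e p b‖ :=
        Finset.sum_comm
    _ ≤ ∑ _p ∈ Pl.filter (fun p => c ∈ supp p), (s : ℝ) * (64 * M₀ / R ^ 3 * ‖A‖) := Finset.sum_le_sum hinner
    _ = ((Pl.filter fun p => c ∈ supp p).card : ℝ) * (s * (64 * M₀ / R ^ 3 * ‖A‖)) := by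
        rw [Finset.sum_const, nsmul_eq_mul]
    _ ≤ (m : ℝ) * (s * (64 * M₀ / R ^ 3 * ‖A‖)) :=
        mul_le_mul_of_nonneg_right (by exact_mod_cast hm c) (by positivity)
    _ = m * s * (64 * M₀ / R ^ 3) * ‖A‖ := by ring

end Hessian

/-! ## §5 THE END: the (P4) letter is pinned-Lipschitz ∕ pinned-quadratic on the flat ball, volume-free, for every pin rate -/

section End

variable [DecidableEq Λ]

/-- **THE PINNED MEAN-VALUE INEQUALITY ON A CONVEX FLAT SET** (file 1 §2's `norm_sub_pin_le_of_kerOpPin_le` with the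
ball replaced by any convex set on which `D` is differentiable): `‖kerOpPin (dker D A) δ′ ϖi ϖo‖ ≤ L` on `s` ⟹
`‖D A − D A′‖_pin ≤ L·‖A − A′‖_pin` for `A, A′ ∈ s`. [folklore] -/
theorem norm_sub_pin_le_of_kerOpPin_le_convex (δ' : ℝ) (ϖi : Λ → ℝ) (ϖo : Λ' → ℝ)
    {D : (Λ → 𝔄) → (Λ' → 𝔅)} {s : Set (Λ → 𝔄)} {L : ℝ} (hs : Convex ℝ s)
    (hD : ∀ A ∈ s, DifferentiableAt ℂ D A) (hL : ∀ A ∈ s, ‖kerOpPin (dker D A) δ' ϖi ϖo‖ ≤ L)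
    {A A' : Λ → 𝔄} (hA : A ∈ s) (hA' : A' ∈ s) :
    ‖((WSup.toPiL (pinW δ' ϖo) 1).symm (D A) - (WSup.toPiL (pinW δ' ϖo) 1).symm (D A') :
        WSup (pinW δ' ϖo) 1 𝔅)‖ ≤
      L * ‖((WSup.toPiL (pinW δ' ϖi) 1).symm A - (WSup.toPiL (pinW δ' ϖi) 1).symm A' :
        WSup (pinW δ' ϖi) 1 𝔄)‖ := by
  set e := WSup.toPiL (𝔄 := 𝔄) (pinW δ' ϖi) 1 with he
  set e' := WSup.toPiL (𝔄 := 𝔅) (pinW δ' ϖo) 1 with he'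
  set s' : Set (WSup (pinW δ' ϖi) 1 𝔄) := {Y | e Y ∈ s} with hs'
  have hconv : Convex ℝ s' :=
    hs.linear_preimage (((e : WSup (pinW δ' ϖi) 1 𝔄 →L[ℂ] (Λ → 𝔄)) :
      WSup (pinW δ' ϖi) 1 𝔄 →ₗ[ℂ] (Λ → 𝔄)).restrictScalars ℝ)
  have hf : ∀ Y ∈ s', HasFDerivWithinAt (fun Y : WSup (pinW δ' ϖi) 1 𝔄 => (e'.symm (D (e Y)) : WSup _ 1 𝔅))
      (kerOpPin (dker D (e Y)) δ' ϖi ϖo) s' Y := fun Y hY =>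
    (hasFDerivAt_conj δ' ϖi ϖo (hD (e Y) hY)).hasFDerivWithinAt
  have hbound : ∀ Y ∈ s', ‖kerOpPin (dker D (e Y)) δ' ϖi ϖo‖ ≤ L := fun Y hY => hL (e Y) hY
  have hAs : e.symm A ∈ s' := by
    show e (e.symm A) ∈ s
    rw [e.apply_symm_apply]; exact hA
  have hA's : e.symm A' ∈ s' := by
    show e (e.symm A') ∈ s
    rw [e.apply_symm_apply]; exact hA'
  have key := hconv.norm_image_sub_le_of_norm_hasFDerivWithin_le hf hbound hA's hAs
  simpa using key

variable {P : Type*} (Pl : Finset P) (φ : P → (Λ → 𝔄) → ℂ) (supp : P → Finset Λ) (ϖ : Λ → ℝ) {R M₀ : ℝ}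

/-- **THE PINNED DERIVATIVE BOUND OF THE (P4) LETTER.**  With the pin profile growing by at most `r₀` inside a plaquette
(`ϖ c ≤ ϖ b + r₀` whenever `b, c ∈ supp p`) and `0 ≤ δ′`: for `A ∈ ball 0 (R∕4)`,
`‖kerOpPin (dker W A) δ′ ϖ ϖ‖ ≤ m·s·(64M₀∕R³)·e^{δ′r₀}·‖A‖` (file 1 §1 `opNorm_kerOpPin_le_of_finiteRange`). [folklore] -/
theorem opNorm_kerOpPin_dker_tail₂_locGrad_le {m s : ℕ} {δ' r₀ : ℝ} (hR : 0 < R) (hM₀ : 0 ≤ M₀) (hδ' : 0 ≤ δ')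
    (ha : ∀ p ∈ Pl, AnalyticOnNhd ℂ (φ p) (ball 0 R))
    (hM : ∀ p ∈ Pl, ∀ A ∈ ball (0 : Λ → 𝔄) R, ‖φ p A‖ ≤ M₀)
    (hloc : ∀ p ∈ Pl, ∀ A : Λ → 𝔄, ∀ b ∉ supp p, ∀ X : 𝔄, φ p (A + Pi.single b X) = φ p A)
    (hm : ∀ b : Λ, (Pl.filter (fun p => b ∈ supp p)).card ≤ m) (hs : ∀ p ∈ Pl, (supp p).card ≤ s)
    (hϖ : ∀ p ∈ Pl, ∀ b ∈ supp p, ∀ c ∈ supp p, ϖ c ≤ ϖ b + r₀)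
    {A : Λ → 𝔄} (hA : A ∈ ball (0 : Λ → 𝔄) (R / 4)) :
    ‖kerOpPin (dker (tail₂ (locGrad (fun A => ∑ p ∈ Pl, φ p A))) A) δ' ϖ ϖ‖ ≤
      m * s * (64 * M₀ / R ^ 3) * Real.exp (δ' * r₀) * ‖A‖ := by
  have hAR : A ∈ ball (0 : Λ → 𝔄) R := ball_subset_ball (by linarith) hA
  have hgrow : ∀ c, ∀ b ∈ (Pl.filter fun p => c ∈ supp p).biUnion supp, ϖ c ≤ ϖ b + r₀ := fun c b hb => by
    obtain ⟨p, hp, hc, hb'⟩ := (mem_range_iff Pl supp).1 hb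
    exact hϖ p hp b hb' c hc
  have h := opNorm_kerOpPin_le_of_finiteRange (dker (tail₂ (locGrad (fun A => ∑ p ∈ Pl, φ p A))) A)
    (fun c => (Pl.filter fun p => c ∈ supp p).biUnion supp) ϖ ϖ hδ' (by positivity)
    (fun c b hb => dker_tail₂_locGrad_eq_zero Pl φ supp hR ha hloc hAR c hb) hgrow
    (fun c => rangeRowSum_dker_tail₂_locGrad_le Pl φ supp hR hM₀ ha hM hloc hm hs hA c)
  calc _ ≤ m * s * (64 * M₀ / R ^ 3) * ‖A‖ * Real.exp (δ' * r₀) := h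
    _ = m * s * (64 * M₀ / R ^ 3) * Real.exp (δ' * r₀) * ‖A‖ := by ring

/-- **THE END (LIPSCHITZ FORM) — THE (P4) LETTER IS PINNED-LIPSCHITZ BY LOCALITY.**  `V = Σ_{p ∈ Pl} φ_p` with every
`φ_p` analytic and bounded by `M₀` on the flat `ball 0 R` and LOCAL to `supp p`; incidence `≤ m`, `#supp p ≤ s`; a pin
profile `ϖ` on the bonds growing by at most `r₀` inside a plaquette; `0 ≤ δ′`.  Then END-II's nonlinearity
`W = tail₂ (locGrad V)` (S62 f1 `prop4Hyp_locGrad`'s object) satisfies, for all `A, A′` in the flat `ball 0 ρ`,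
`ρ ≤ R∕4`:  `‖W A − W A′‖_pin ≤ (m·s·(64M₀∕R³)·e^{δ′r₀}·ρ)·‖A − A′‖_pin`  in S69's `WSup (pinW δ′ ϖ) 1` — VOLUME-FREE,
`T`-free, no `δ′ < δ₀` condition.  Nothing printed is asserted. [folklore] -/
theorem norm_sub_pin_tail₂_locGrad_le {m s : ℕ} {ρ δ' r₀ : ℝ} (hR : 0 < R) (hM₀ : 0 ≤ M₀) (hρR : ρ ≤ R / 4)
    (hδ' : 0 ≤ δ')
    (ha : ∀ p ∈ Pl, AnalyticOnNhd ℂ (φ p) (ball 0 R))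
    (hM : ∀ p ∈ Pl, ∀ A ∈ ball (0 : Λ → 𝔄) R, ‖φ p A‖ ≤ M₀)
    (hloc : ∀ p ∈ Pl, ∀ A : Λ → 𝔄, ∀ b ∉ supp p, ∀ X : 𝔄, φ p (A + Pi.single b X) = φ p A)
    (hm : ∀ b : Λ, (Pl.filter (fun p => b ∈ supp p)).card ≤ m) (hs : ∀ p ∈ Pl, (supp p).card ≤ s)
    (hϖ : ∀ p ∈ Pl, ∀ b ∈ supp p, ∀ c ∈ supp p, ϖ c ≤ ϖ b + r₀)
    {A A' : Λ → 𝔄} (hA : A ∈ ball (0 : Λ → 𝔄) ρ) (hA' : A' ∈ ball (0 : Λ → 𝔄) ρ) :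
    ‖((WSup.toPiL (pinW δ' ϖ) 1).symm (tail₂ (locGrad (fun A => ∑ p ∈ Pl, φ p A)) A) -
        (WSup.toPiL (pinW δ' ϖ) 1).symm (tail₂ (locGrad (fun A => ∑ p ∈ Pl, φ p A)) A') :
          WSup (pinW δ' ϖ) 1 (𝔄 →L[ℂ] ℂ))‖ ≤
      m * s * (64 * M₀ / R ^ 3) * Real.exp (δ' * r₀) * ρ *
        ‖((WSup.toPiL (pinW δ' ϖ) 1).symm A - (WSup.toPiL (pinW δ' ϖ) 1).symm A' : WSup (pinW δ' ϖ) 1 𝔄)‖ := by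
  have hVa : AnalyticOnNhd ℂ (fun A => ∑ p ∈ Pl, φ p A) (ball (0 : Λ → 𝔄) R) := analyticOnNhd_sum Pl φ ha
  have hWd : DifferentiableOn ℂ (tail₂ (locGrad (fun A => ∑ p ∈ Pl, φ p A))) (ball (0 : Λ → 𝔄) R) :=
    ShellMeasureLocalGradientTail.differentiableOn_tail₂ (differentiableOn_locGrad hVa)
  have hsub : ball (0 : Λ → 𝔄) ρ ⊆ ball 0 (R / 4) := ball_subset_ball hρR
  refine norm_sub_pin_le_of_kerOpPin_le_convex δ' ϖ ϖ (convex_ball (0 : Λ → 𝔄) ρ)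
    (fun A₁ hA₁ => hWd.differentiableAt (isOpen_ball.mem_nhds (ball_subset_ball (by linarith) hA₁)))
    (fun A₁ hA₁ => ?_) hA hA'
  have hA₁ρ : ‖A₁‖ ≤ ρ := (mem_ball_zero_iff.1 hA₁).le
  calc _ ≤ m * s * (64 * M₀ / R ^ 3) * Real.exp (δ' * r₀) * ‖A₁‖ :=
        opNorm_kerOpPin_dker_tail₂_locGrad_le Pl φ supp ϖ hR hM₀ hδ' ha hM hloc hm hs hϖ (hsub hA₁)
    _ ≤ m * s * (64 * M₀ / R ^ 3) * Real.exp (δ' * r₀) * ρ := by gcongr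

/-- **THE END (SHARP VARIATION FORM)**: for `A ∈ ball 0 (R∕4)`,
`‖W A‖_pin ≤ (m·s·(64M₀∕R³)·e^{δ′r₀}·‖A‖_flat)·‖A‖_pin` (`W 0 = 0`; the mean value on the flat closed ball of radius
`‖A‖`, where the pinned derivative bound is linear in the size). [folklore] -/
theorem norm_pin_tail₂_locGrad_le {m s : ℕ} {δ' r₀ : ℝ} (hR : 0 < R) (hM₀ : 0 ≤ M₀) (hδ' : 0 ≤ δ')
    (ha : ∀ p ∈ Pl, AnalyticOnNhd ℂ (φ p) (ball 0 R))
    (hM : ∀ p ∈ Pl, ∀ A ∈ ball (0 : Λ → 𝔄) R, ‖φ p A‖ ≤ M₀)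
    (hloc : ∀ p ∈ Pl, ∀ A : Λ → 𝔄, ∀ b ∉ supp p, ∀ X : 𝔄, φ p (A + Pi.single b X) = φ p A)
    (hm : ∀ b : Λ, (Pl.filter (fun p => b ∈ supp p)).card ≤ m) (hs : ∀ p ∈ Pl, (supp p).card ≤ s)
    (hϖ : ∀ p ∈ Pl, ∀ b ∈ supp p, ∀ c ∈ supp p, ϖ c ≤ ϖ b + r₀)
    {A : Λ → 𝔄} (hA : A ∈ ball (0 : Λ → 𝔄) (R / 4)) :
    ‖((WSup.toPiL (pinW δ' ϖ) 1).symm (tail₂ (locGrad (fun A => ∑ p ∈ Pl, φ p A)) A) :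
          WSup (pinW δ' ϖ) 1 (𝔄 →L[ℂ] ℂ))‖ ≤
      m * s * (64 * M₀ / R ^ 3) * Real.exp (δ' * r₀) * ‖A‖ *
        ‖((WSup.toPiL (pinW δ' ϖ) 1).symm A : WSup (pinW δ' ϖ) 1 𝔄)‖ := by
  have hAn : ‖A‖ < R / 4 := mem_ball_zero_iff.1 hA
  have hVa : AnalyticOnNhd ℂ (fun A => ∑ p ∈ Pl, φ p A) (ball (0 : Λ → 𝔄) R) := analyticOnNhd_sum Pl φ ha
  have hWd : DifferentiableOn ℂ (tail₂ (locGrad (fun A => ∑ p ∈ Pl, φ p A))) (ball (0 : Λ → 𝔄) R) :=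
    ShellMeasureLocalGradientTail.differentiableOn_tail₂ (differentiableOn_locGrad hVa)
  -- the mean value on the flat CLOSED ball of radius `‖A‖`, inside `ball 0 (R∕4)`
  have hsub : closedBall (0 : Λ → 𝔄) ‖A‖ ⊆ ball 0 (R / 4) := closedBall_subset_ball hAn
  have h := norm_sub_pin_le_of_kerOpPin_le_convex δ' ϖ ϖ (convex_closedBall (0 : Λ → 𝔄) ‖A‖)
    (D := tail₂ (locGrad (fun A => ∑ p ∈ Pl, φ p A)))
    (L := m * s * (64 * M₀ / R ^ 3) * Real.exp (δ' * r₀) * ‖A‖)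
    (fun A₁ hA₁ => hWd.differentiableAt (isOpen_ball.mem_nhds (ball_subset_ball (by linarith) (hsub hA₁))))
    (fun A₁ hA₁ => ?_) (mem_closedBall_zero_iff.2 le_rfl) (mem_closedBall_self (norm_nonneg A))
  · simpa [ShellMeasureLocalGradientTail.tail₂_zero] using h
  · have hA₁n : ‖A₁‖ ≤ ‖A‖ := mem_closedBall_zero_iff.1 hA₁
    calc _ ≤ m * s * (64 * M₀ / R ^ 3) * Real.exp (δ' * r₀) * ‖A₁‖ :=
          opNorm_kerOpPin_dker_tail₂_locGrad_le Pl φ supp ϖ hR hM₀ hδ' ha hM hloc hm hs hϖ (hsub hA₁)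
      _ ≤ m * s * (64 * M₀ / R ^ 3) * Real.exp (δ' * r₀) * ‖A‖ := by gcongr

/-- **THE END (END-II's SHAPE) — `Prop4Hyp` OF THE (P4) LETTER BETWEEN THE PINNED SPACES.**  With `0 ≤ δ′` and a
NONNEGATIVE pin profile (`0 ≤ ϖ`, so that the flat size is below the pinned size, S69 `norm_toPiL_le_of_nonneg`), the
(P4) letter read between S69's pinned spaces,
`Y ↦ toPiL⁻¹ (tail₂ (locGrad V) (toPiL Y)) : WSup (pinW δ′ ϖ) 1 𝔄 → WSup (pinW δ′ ϖ) 1 (𝔄 →L[ℂ] ℂ)`,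
satisfies `B11Prop6Scheme.Prop4Hyp` with `C₄ = m·s·(64M₀∕R³)·e^{δ′r₀}` and `a₃ = R∕4` — END-II-loc's binder `hW` at the
pinned instantiation `𝒴 := WSup (pinW δ′ ϖ) 1 𝔄` (row S70 f3 `ShellMeasureLandauPinnedEnd`, [dict] node O) for the
∇-free, `HD`-free one-grid letter, with a VOLUME-FREE constant and NO decay display ([Balaban1985Variational] (97)∕(98)
TYPE — locator only; nothing printed is asserted). [folklore] -/
theorem prop4Hyp_pinned_tail₂_locGrad {m s : ℕ} {δ' r₀ : ℝ} (hR : 0 < R) (hM₀ : 0 ≤ M₀) (hδ' : 0 ≤ δ')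
    (hϖ0 : ∀ b, 0 ≤ ϖ b)
    (ha : ∀ p ∈ Pl, AnalyticOnNhd ℂ (φ p) (ball 0 R))
    (hM : ∀ p ∈ Pl, ∀ A ∈ ball (0 : Λ → 𝔄) R, ‖φ p A‖ ≤ M₀)
    (hloc : ∀ p ∈ Pl, ∀ A : Λ → 𝔄, ∀ b ∉ supp p, ∀ X : 𝔄, φ p (A + Pi.single b X) = φ p A)
    (hm : ∀ b : Λ, (Pl.filter (fun p => b ∈ supp p)).card ≤ m) (hs : ∀ p ∈ Pl, (supp p).card ≤ s)
    (hϖ : ∀ p ∈ Pl, ∀ b ∈ supp p, ∀ c ∈ supp p, ϖ c ≤ ϖ b + r₀) :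
    Prop4Hyp
      (fun Y : WSup (pinW δ' ϖ) 1 𝔄 =>
        ((WSup.toPiL (pinW δ' ϖ) 1).symm
          (tail₂ (locGrad (fun A => ∑ p ∈ Pl, φ p A)) (WSup.toPiL (pinW δ' ϖ) 1 Y)) :
            WSup (pinW δ' ϖ) 1 (𝔄 →L[ℂ] ℂ)))
      (m * s * (64 * M₀ / R ^ 3) * Real.exp (δ' * r₀)) (R / 4) where
  quad Y hY := by
    have hflat : ‖WSup.toPiL (pinW δ' ϖ) 1 Y‖ ≤ ‖Y‖ :=
      ShellMeasurePinnedNorm.norm_toPiL_le_of_nonneg hδ' hϖ0 Y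
    have hA : WSup.toPiL (pinW δ' ϖ) 1 Y ∈ ball (0 : Λ → 𝔄) (R / 4) :=
      mem_ball_zero_iff.2 (hflat.trans_lt hY)
    have h := norm_pin_tail₂_locGrad_le Pl φ supp ϖ hR hM₀ hδ' ha hM hloc hm hs hϖ hA
    rw [(WSup.toPiL (pinW δ' ϖ) 1).symm_apply_apply] at h
    have hK : 0 ≤ m * s * (64 * M₀ / R ^ 3) * Real.exp (δ' * r₀) := by positivity
    calc _ ≤ m * s * (64 * M₀ / R ^ 3) * Real.exp (δ' * r₀) * ‖WSup.toPiL (pinW δ' ϖ) 1 Y‖ * ‖Y‖ := h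
      _ ≤ m * s * (64 * M₀ / R ^ 3) * Real.exp (δ' * r₀) * ‖Y‖ * ‖Y‖ := by gcongr
      _ = m * s * (64 * M₀ / R ^ 3) * Real.exp (δ' * r₀) * ‖Y‖ ^ 2 := by ring
  differentiableOn := by
    have hVa : AnalyticOnNhd ℂ (fun A => ∑ p ∈ Pl, φ p A) (ball (0 : Λ → 𝔄) R) := analyticOnNhd_sum Pl φ ha
    have hWd : DifferentiableOn ℂ (tail₂ (locGrad (fun A => ∑ p ∈ Pl, φ p A))) (ball (0 : Λ → 𝔄) R) :=
      ShellMeasureLocalGradientTail.differentiableOn_tail₂ (differentiableOn_locGrad hVa)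
    have hmaps : MapsTo (WSup.toPiL (𝔄 := 𝔄) (pinW δ' ϖ) 1) {Y : WSup (pinW δ' ϖ) 1 𝔄 | ‖Y‖ < R / 4}
        (ball (0 : Λ → 𝔄) R) := fun Y hY =>
      mem_ball_zero_iff.2 (((ShellMeasurePinnedNorm.norm_toPiL_le_of_nonneg hδ' hϖ0 Y).trans_lt hY).trans
        (by linarith))
    exact (WSup.toPiL (𝔄 := 𝔄 →L[ℂ] ℂ) (pinW δ' ϖ) 1).symm.differentiable.comp_differentiableOn
      (hWd.comp (WSup.toPiL (𝔄 := 𝔄) (pinW δ' ϖ) 1).differentiable.differentiableOn hmaps)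

end End

end Summit.QuantumFields.BalabanUV.T4Continuum.ShellMeasureGradientPinnedLocalEnd

end
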